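import Summits.QuantumFields.GaugeBoot.EquipartitionBootstrap
import HarnessLib

/-!
# Gauge-boot: the equipartition bound at every feasible point of the lane's `U(N)` word SDP of level `≥ 4`
# (large-`N` supplement 18, part 5e — the `U(N)` twin of part 5d)

HONEST FRAMING (cell `pub-gaugeboot`, page 1 of every file): certified bounds on lattice
expectations at STATED coupling, gauge group, dimension and torus size; NOT a mass gap, NOT a
continuum limit, NOT a string tension, NOT large `N`; NOT Yang–Mills-summit-bearing (barriers
`FixedCouplingUltralocality`, `PerturbativeInvisibility`).  A statement about the cell's `U(N)` SDPs; it certifies no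
number of CERTIFIED.md.

## Content

Part 5d verbatim for the lane's `U(N)` bootstrap (`unitaryFundamentalLatticeRep N`, `uExp N` — ALL skew-Hermitian
directions, weight `s = 0`, polarisation `sdPairF_of_skew`):

* ★★ `sdPairF_of_isBootstrapFeasible_uN` — a level-`n` feasible functional has the pair rows for every word of length `≤ n`
  and every direction;
* ★★★ `sum_wordLoop_le_of_isBootstrapFeasible_uN` / `avg_…_uN` — **for `N ≥ 1`, `d ≥ 2`, `L ≥ 2`, `β ≥ 0` and every functional
  feasible for the `U(N)` word SDP at any level `n ≥ 4`: `(1/(2(d−1)))·Σ_{P̃∋e} φ(W(P̃)) ≤ 1 − N/(4(d−1)β + N)`**, i.e.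
  `1 − avg ≥ 1/(4(d−1)β/N + 1)` — uniform in `N` at fixed `β/N` (Kazakov–Zheng's `U(N)` rows are `N`-free).
[folklore]
-/

noncomputable section

open Filter Topology NormedSpace
open scoped Matrix.Norms.Frobenius Matrix
open Literature.MathematicalPhysics.QuantumFieldTheory
open Literature.MathematicalPhysics.QuantumLattice (unitaryFundamentalLatticeRep unitaryFundamentalRep unitaryFundamentalLatticeRep_N)
open Summit.QuantumFields.YangMills.Cruxes.CurvatureAmnesia.WardDefect.SchwingerDyson

namespace Summit.QuantumFields.GaugeBoot

section UN

variable {d L N : ℕ}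

/-- ★★ **A level-`n` feasible functional of the `U(N)` word SDP has the pair rows** (part 5a's `SDPairF`) for every
word of length `≤ n` and EVERY direction `X` (no trace condition: `𝔲(N)`). [folklore] -/
theorem sdPairF_of_isBootstrapFeasible_uN [NeZero L] {n : ℕ} {β : ℝ}
    {φ : C(GaugeConfig d L (Matrix.unitaryGroup (Fin N) ℂ), ℝ) →ₗ[ℝ] ℝ}
    (hφ : IsBootstrapFeasible (unitaryFundamentalLatticeRep N) (uExp N) (fun _ => wilsonAction (unitaryFundamentalRep (Fin N) ℂ)) β
      (wordTruncation (ι := Edge d L) (unitaryFundamentalLatticeRep N) n) φ)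
    (x : Site d L) (μ : Fin d) (x₀ : Site d L) (w : Word d) (hw : w.length ≤ n)
    (X : Matrix (Fin N) (Fin N) ℂ) : SDPairF (unitaryFundamentalLatticeRep N) φ β x μ x₀ w X := by
  refine sdPairF_of_skew (unitaryFundamentalLatticeRep N) φ β x μ x₀ w (fun Z hZs => ?_) X
  clear X
  -- the direction as a generator of `U(N)`
  have hZskew : (Z : Matrix (Fin N) (Fin N) ℂ) ∈ skewAdjoint (Matrix (Fin N) (Fin N) ℂ) := by
    change star Z = -Z
    rw [Matrix.star_eq_conjTranspose]; exact hZs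
  let Zg : UGenerator N := ⟨Z, hZskew⟩
  have hk : ∀ s t, uExp N Zg (s + t) = uExp N Zg s * uExp N Zg t := uExp_add N Zg
  have hkX : ∀ t, (unitaryFundamentalLatticeRep N).ρ (uExp N Zg t) = exp ((t : ℂ) • Z) := fun t => rho_uExp N Zg t
  -- the action derivative of the feasibility witness is `actionDeriv`
  obtain ⟨S', -, hS'der, hrows⟩ := hφ.2.2 (x, μ) Zg
  have hS' : ∀ U, S' U = actionDeriv (unitaryFundamentalLatticeRep N).ρ (x, μ) Z U := fun U =>
    (hS'der U).unique (hasDerivAt_wilsonAction (e := (x, μ)) hk hkX U)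
  intro Y
  -- the test functions `Re/Im tr(Y ρ(hol_w))` and their derivatives `Re/Im tr(Y insDeriv)` are word functions
  have hV : EntriesIn (unitaryFundamentalLatticeRep N) (Set.univ : Set (Edge d L)) w.length
      (fun U : GaugeConfig d L _ => Y * (unitaryFundamentalLatticeRep N).ρ (wordHolonomy U x₀ w)) := by
    simpa using (entriesIn_const (unitaryFundamentalLatticeRep N) (Set.univ : Set (Edge d L)) 0 Y).mul (unitaryFundamentalLatticeRep N)
      (entriesIn_wordHolonomy (unitaryFundamentalLatticeRep N) x₀ w)
  have hD : EntriesIn (unitaryFundamentalLatticeRep N) (Set.univ : Set (Edge d L)) w.length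
      (fun U : GaugeConfig d L _ => Y * insDeriv (unitaryFundamentalLatticeRep N).ρ (x, μ) Z U x₀ w) := by
    simpa using (entriesIn_const (unitaryFundamentalLatticeRep N) (Set.univ : Set (Edge d L)) 0 Y).mul (unitaryFundamentalLatticeRep N)
      (entriesIn_insDeriv (unitaryFundamentalLatticeRep N) (x, μ) Z x₀ w)
  obtain ⟨gre, hgre, hgre'⟩ := (mem_wordFunctions_iff (unitaryFundamentalLatticeRep N)).1 hV.trace_re
  obtain ⟨gim, hgim, hgim'⟩ := (mem_wordFunctions_iff (unitaryFundamentalLatticeRep N)).1 (hV.trace_im (unitaryFundamentalLatticeRep N))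
  obtain ⟨dre, hdre, hdre'⟩ := (mem_wordFunctions_iff (unitaryFundamentalLatticeRep N)).1 hD.trace_re
  obtain ⟨dim, hdim, hdim'⟩ := (mem_wordFunctions_iff (unitaryFundamentalLatticeRep N)).1 (hD.trace_im (unitaryFundamentalLatticeRep N))
  have hgreV : gre ∈ wordTruncation (ι := Edge d L) (unitaryFundamentalLatticeRep N) n :=
    wordTruncation_mono (unitaryFundamentalLatticeRep N) hw (mem_wordTruncation_of_mem_wordSpace (unitaryFundamentalLatticeRep N) hgre)
  have hgimV : gim ∈ wordTruncation (ι := Edge d L) (unitaryFundamentalLatticeRep N) n :=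
    wordTruncation_mono (unitaryFundamentalLatticeRep N) hw (mem_wordTruncation_of_mem_wordSpace (unitaryFundamentalLatticeRep N) hgim)
  -- the derivative facts along the shift `U ↦ U[e ↦ e^{tZ} U_e]` (chain rule with a real-linear map)
  have hder_re : ∀ U : GaugeConfig d L (Matrix.unitaryGroup (Fin N) ℂ),
      HasDerivAt (fun t : ℝ => gre (Function.update U (x, μ) (uExp N Zg t * U (x, μ)))) (dre U) 0 := by
    intro U
    have h1 := hasDerivAt_wordHolonomy (e := (x, μ)) hk hkX U x₀ w
    have h2 := (Complex.reCLM.comp (traceMulLeftCLM Y)).hasFDerivAt.comp_hasDerivAt (0 : ℝ) h1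
    have e1 : (fun t : ℝ => gre (Function.update U (x, μ) (uExp N Zg t * U (x, μ)))) =
        (⇑(Complex.reCLM.comp (traceMulLeftCLM Y)) ∘ fun t : ℝ =>
          (unitaryFundamentalLatticeRep N).ρ (wordHolonomy (Function.update U (x, μ) (uExp N Zg t * U (x, μ))) x₀ w)) := by
      funext t
      simp only [Function.comp_apply, ContinuousLinearMap.comp_apply, traceMulLeftCLM_apply, Complex.reCLM_apply, hgre']
    have e2 : dre U = (Complex.reCLM.comp (traceMulLeftCLM Y)) (insDeriv (unitaryFundamentalLatticeRep N).ρ (x, μ) Z U x₀ w) := by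
      simp only [ContinuousLinearMap.comp_apply, traceMulLeftCLM_apply, Complex.reCLM_apply, hdre']
    rw [e1, e2]
    exact h2
  have hder_im : ∀ U : GaugeConfig d L (Matrix.unitaryGroup (Fin N) ℂ),
      HasDerivAt (fun t : ℝ => gim (Function.update U (x, μ) (uExp N Zg t * U (x, μ)))) (dim U) 0 := by
    intro U
    have h1 := hasDerivAt_wordHolonomy (e := (x, μ)) hk hkX U x₀ w
    have h2 := (Complex.imCLM.comp (traceMulLeftCLM Y)).hasFDerivAt.comp_hasDerivAt (0 : ℝ) h1
    have e1 : (fun t : ℝ => gim (Function.update U (x, μ) (uExp N Zg t * U (x, μ)))) =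
        (⇑(Complex.imCLM.comp (traceMulLeftCLM Y)) ∘ fun t : ℝ =>
          (unitaryFundamentalLatticeRep N).ρ (wordHolonomy (Function.update U (x, μ) (uExp N Zg t * U (x, μ))) x₀ w)) := by
      funext t
      simp only [Function.comp_apply, ContinuousLinearMap.comp_apply, traceMulLeftCLM_apply, Complex.imCLM_apply, hgim']
    have e2 : dim U = (Complex.imCLM.comp (traceMulLeftCLM Y)) (insDeriv (unitaryFundamentalLatticeRep N).ρ (x, μ) Z U x₀ w) := by
      simp only [ContinuousLinearMap.comp_apply, traceMulLeftCLM_apply, Complex.imCLM_apply, hdim']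
    rw [e1, e2]
    exact h2
  -- the rows
  have hrow_re := hrows gre hgreV dre (mem_polyAlgebra_of_mem_wordSpace (unitaryFundamentalLatticeRep N) hdre) hder_re
  have hrow_im := hrows gim hgimV dim (mem_polyAlgebra_of_mem_wordSpace (unitaryFundamentalLatticeRep N) hdim) hder_im
  -- the right-hand side `tr(Y ρ(hol_w))·(−½ plaqIns_Z)` is `tr(Y ρ(hol_w))·S'` (a real factor)
  have hrhs : ∀ U, (Y * (unitaryFundamentalLatticeRep N).ρ (wordHolonomy U x₀ w)).trace *
      (-(1 / 2) * plaqIns (unitaryFundamentalLatticeRep N).ρ Z U x μ) =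
      (Y * (unitaryFundamentalLatticeRep N).ρ (wordHolonomy U x₀ w)).trace * ((S' U : ℝ) : ℂ) := fun U => by
    rw [hS' U, actionDeriv_eq_plaqIns hZs (unitaryFundamentalLatticeRep N).mem_unitary U x μ]
  have hLre : evalR φ (fun U => ((Y * insDeriv (unitaryFundamentalLatticeRep N).ρ (x, μ) Z U x₀ w).trace).re) = φ dre := by
    rw [← hdre', evalR_coe]
  have hLim : evalR φ (fun U => ((Y * insDeriv (unitaryFundamentalLatticeRep N).ρ (x, μ) Z U x₀ w).trace).im) = φ dim := by
    rw [← hdim', evalR_coe]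
  have hRre : evalR φ (fun U => ((Y * (unitaryFundamentalLatticeRep N).ρ (wordHolonomy U x₀ w)).trace *
      (-(1 / 2) * plaqIns (unitaryFundamentalLatticeRep N).ρ Z U x μ)).re) = φ (gre * S') := by
    have e1 : (fun U => ((Y * (unitaryFundamentalLatticeRep N).ρ (wordHolonomy U x₀ w)).trace *
        (-(1 / 2) * plaqIns (unitaryFundamentalLatticeRep N).ρ Z U x μ)).re) = ⇑(gre * S') := by
      funext U
      rw [hrhs U, Complex.re_mul_ofReal, ContinuousMap.mul_apply, hgre']
    rw [e1, evalR_coe]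
  have hRim : evalR φ (fun U => ((Y * (unitaryFundamentalLatticeRep N).ρ (wordHolonomy U x₀ w)).trace *
      (-(1 / 2) * plaqIns (unitaryFundamentalLatticeRep N).ρ Z U x μ)).im) = φ (gim * S') := by
    have e1 : (fun U => ((Y * (unitaryFundamentalLatticeRep N).ρ (wordHolonomy U x₀ w)).trace *
        (-(1 / 2) * plaqIns (unitaryFundamentalLatticeRep N).ρ Z U x μ)).im) = ⇑(gim * S') := by
      funext U
      rw [hrhs U, Complex.im_mul_ofReal, ContinuousMap.mul_apply, hgim']
    rw [e1, evalR_coe]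
  apply Complex.ext
  · rw [evalC_re, hLre, Complex.re_ofReal_mul, evalC_re, hRre, hrow_re]
  · rw [evalC_im, hLim, Complex.im_ofReal_mul, evalC_im, hRim, hrow_im]

/-- ★★★ **THE EQUIPARTITION BOUND AT EVERY FEASIBLE POINT OF THE `U(N)` WORD SDP.**  For `N ≥ 1`, `d ≥ 2`, a torus of
side `L ≥ 2`, tree coupling `β ≥ 0`, and every functional `φ` feasible for the lane's `U(N)` word-level-`n` bootstrap
with `n ≥ 4`: `Σ_{ν≠μ, ε} φ(W(P̃_{ν,ε})) ≤ 2(d−1)·(1 − N/(4(d−1)β + N))` — `N`-uniform after division: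
`1 − avg ≥ 1/(4(d−1)β/N + 1)`. [folklore] -/
theorem sum_wordLoop_le_of_isBootstrapFeasible_uN [NeZero L] (hN : 1 ≤ N) {n : ℕ} (hn : 4 ≤ n)
    (hL : (1 : ZMod L) ≠ 0) (hd : 2 ≤ d) {β : ℝ} (hβ : 0 ≤ β)
    {φ : C(GaugeConfig d L (Matrix.unitaryGroup (Fin N) ℂ), ℝ) →ₗ[ℝ] ℝ}
    (hφ : IsBootstrapFeasible (unitaryFundamentalLatticeRep N) (uExp N) (fun _ => wilsonAction (unitaryFundamentalRep (Fin N) ℂ)) β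
      (wordTruncation (ι := Edge d L) (unitaryFundamentalLatticeRep N) n) φ)
    (x : Site d L) (μ : Fin d) :
    (∑ ν ∈ Finset.univ.erase μ, ∑ ε : Bool, φ (wordLoopCM (unitaryFundamentalLatticeRep N) x (plaqWord μ ν ε))) ≤
      2 * ((d : ℝ) - 1) * (1 - (N : ℝ) / (4 * ((d : ℝ) - 1) * β + N)) := by
  have hN2 : (0 : ℝ) < ((unitaryFundamentalLatticeRep N).N : ℝ) ^ 2 := by
    rw [unitaryFundamentalLatticeRep_N]
    have : (1 : ℝ) ≤ N := by exact_mod_cast hN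
    positivity
  have hP : ∀ ν ∈ Finset.univ.erase μ, ∀ (ε : Bool) (i j : Fin (unitaryFundamentalLatticeRep N).N),
      SDPairF (unitaryFundamentalLatticeRep N) φ β x μ x (plaqWord μ ν ε) (unitDir ((0 : ℝ) : ℂ) i j) := by
    intro ν _ ε i j
    rw [Complex.ofReal_zero]
    exact sdPairF_of_isBootstrapFeasible_uN hφ x μ x (plaqWord μ ν ε) ((length_plaqWord μ ν ε).trans_le hn) _
  have h := Equipartition.sum_evalR_plaquette_le_of_sdPairF (unitaryFundamentalLatticeRep N) φ hL hd hβ x μ le_rfl hN2 hn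
    hφ.1 hφ.2.1 hP
  have hev : ∀ ν ε, evalR φ (fun U => ((unitaryFundamentalLatticeRep N).N : ℝ)⁻¹ *
      ((unitaryFundamentalLatticeRep N).ρ (wordHolonomy U x (plaqWord μ ν ε))).trace.re) =
      φ (wordLoopCM (unitaryFundamentalLatticeRep N) x (plaqWord μ ν ε)) := fun ν ε => by
    have e1 : (fun U => ((unitaryFundamentalLatticeRep N).N : ℝ)⁻¹ *
        ((unitaryFundamentalLatticeRep N).ρ (wordHolonomy U x (plaqWord μ ν ε))).trace.re) =
        ⇑(wordLoopCM (unitaryFundamentalLatticeRep N) x (plaqWord μ ν ε)) := by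
      funext U; rw [wordLoopCM_apply, wordLoop]
    rw [e1, evalR_coe]
  simp only [hev] at h
  simpa [unitaryFundamentalLatticeRep_N] using h

/-- The same for the AVERAGE over the `2(d−1)` plaquettes through the edge (`U(N)`):
`(1/(2(d−1)))·Σ φ(W(P̃_{ν,ε})) ≤ 1 − N/(4(d−1)β + N)`. [folklore] -/
theorem avg_wordLoop_le_of_isBootstrapFeasible_uN [NeZero L] (hN : 1 ≤ N) {n : ℕ} (hn : 4 ≤ n)
    (hL : (1 : ZMod L) ≠ 0) (hd : 2 ≤ d) {β : ℝ} (hβ : 0 ≤ β)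
    {φ : C(GaugeConfig d L (Matrix.unitaryGroup (Fin N) ℂ), ℝ) →ₗ[ℝ] ℝ}
    (hφ : IsBootstrapFeasible (unitaryFundamentalLatticeRep N) (uExp N) (fun _ => wilsonAction (unitaryFundamentalRep (Fin N) ℂ)) β
      (wordTruncation (ι := Edge d L) (unitaryFundamentalLatticeRep N) n) φ)
    (x : Site d L) (μ : Fin d) :
    (2 * ((d : ℝ) - 1))⁻¹ *
        (∑ ν ∈ Finset.univ.erase μ, ∑ ε : Bool, φ (wordLoopCM (unitaryFundamentalLatticeRep N) x (plaqWord μ ν ε))) ≤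
      1 - (N : ℝ) / (4 * ((d : ℝ) - 1) * β + N) := by
  have hd0 : (0 : ℝ) < 2 * ((d : ℝ) - 1) := by
    have : (2 : ℝ) ≤ d := by exact_mod_cast hd
    linarith
  rw [inv_mul_le_iff₀ hd0]
  exact sum_wordLoop_le_of_isBootstrapFeasible_uN hN hn hL hd hβ hφ x μ

end UN

end Summit.QuantumFields.GaugeBoot

end
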